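import Summits.ABC.IUTFork.Thm311RealArchInd1StripCarrier
import Summits.ABC.IUTFork.Thm311RealInd1StripSignature
import HarnessLib

/-!
# [IUTchIII] Theorem 3.11 (i) (Ind1), PRINT-LITERAL AT EVERY PLACE: the real signature with print's strip slot at the
# finite AND the archimedean places, and the SANDWICH «print (finite only) ≤ print (all places) ≤ Dupuy–Hilado»

Record file (D-0012) of the abc-iut cell (WAVE-4 D-0067 cone-interior discharge prover, seat abc-iut-w4-d001, gen 6;
home layer L6; D-0079 letter L-K, row «R9-ARCH» part 3); TAKES NO SIDE on [IUTchIII] Cor. 3.12. Sequel of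
`Thm311RealArchInd1StripCarrier.lean` (print's archimedean (Ind1) strip part `Real.ind1StripArch w = {1, −1}`) and of
abc-iut-c312-1's `Thm311RealInd1StripSignature.lean` (print's strip slot at the FINITE places `Real.stripPrint`, there
`= stripAutDH = {1}` at the infinite places: «the archimedean strip part … is NOT typed here»; sandwich
`indGroup_ismPrint_le_print` / `indGroup_print_le_DH`).

TYPED: `Real.stripPrintAll logv` — the strip slot that is c312-1's `Real.ind1Strip logv v` at `v ∈ 𝕍^non` AND this seat's
`Real.ind1StripArch w` at `w ∈ 𝕍^arc` (print's (Ind1) strip part at EVERY place); `Real.logShellsPrintAll X logv` —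
abc-iut-c312-5's real `Thm311.LogShells` with THIS strip slot and c312-1's print Ism slot `Real.ismPrint`.

PROVED: `Real.stripPrint_subset_stripPrintAll` (c312-1's slot `⊆` the every-place slot; EQUAL at finite places, `{1} ⊂ {±1}`
at infinite ones), `Real.stripPrintAll_subset_ismDH` (print's every-place strip slot `⊆` the typed DH (Ind2) slot —
finite: c312-1 `ind1Strip_subset_ismDH`; infinite: `ind1StripArch_eq_ismDH`), `Real.Ind1_print_subset_Ind1_printAll`,
`Real.indGroup_print_le_printAll`, `Real.ind1Family_printAll_subset_indGroup_DH` (an (Ind1)-family over print's every-place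
strip slot is a capsule permutation COMPOSED WITH an (Ind2)-family over DH's slot) and the SANDWICH
**`Real.indGroup_printAll_le_DH`**: `⟨Ind1, Ind2⟩(stripPrintAll, ismPrint) ≤ ⟨Ind1, Ind2⟩(stripAutDH, ismDH)`, assembled
as **`Real.indGroup_chain_ismPrint_print_printAll_DH`**:
`⟨Ind1,Ind2⟩(stripAutDH, ismPrint) ≤ ⟨…⟩(stripPrint, ismPrint) ≤ ⟨…⟩(stripPrintAll, ismPrint) ≤ ⟨…⟩(stripAutDH, ismDH)` —
so adding print's ARCHIMEDEAN strip automorphisms changes nothing that is quantified over Dupuy–Hilado's group: every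
`∀`-clause over DH's group (log-volume invariance, the typed Thm 3.11 premise) restricts, and every hull/orbit countermodel
of record formed over DH's group transfers verbatim to print's reading of (Ind1) at ALL places together with print's
finite (Ind2). (Print's archimedean (Ind2) — the Klein four-group, `Thm311RealArchInd2Print` — is the one slot where print
EXCEEDS the typed DH slot; it is not used here.)

HONEST SCOPE: statements about OUR typed objects; the capsule-index permutations of (Ind1) are abc-iut-c312-1's
`LogShells.Ind1` (unchanged); nothing here asserts or refutes [IUTchIII] Cor. 3.12. [claim: Mochizuki2012, status: disputed];
[cite: DupuyHilado2025, §4.7]; [cite: DupuyHilado2025, §4.9]. typed ≠ proved; instantiated ≠ endorsed.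
-/

set_option autoImplicit false

noncomputable section

namespace Summit.ABC.IUTFork.Thm311.Real

open NumberField IsDedekindDomain Literature.IUT.LogVolume Literature.IUT.LogThetaLattice

variable {F : Type} [Field F] [NumberField F] (X : PilotData F) (logv : PadicLogs F)

/-! ## 1. Print's strip slot at EVERY place -/

/-- **PRINT'S (Ind1) STRIP SLOT AT EVERY PLACE**: abc-iut-c312-1's `Real.ind1Strip logv v` at the finite places
(automorphisms of `G_v` through THE equivariant lift and `log_v`) and `Real.ind1StripArch w` at the infinite places
(automorphisms of the split monoid `†𝒟⊢_w` through THE lift to the universal covering). [claim: Mochizuki2012, status: disputed] -/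
def stripPrintAll (logv : PadicLogs F) : ∀ x : Place F, Set (Carrier x ≃ₗ[ℚ] Carrier x)
  | .inl w => ind1StripArch w
  | .inr v => ind1Strip logv v

/-- The identity lies in the every-place strip slot. [folklore] -/
theorem refl_mem_stripPrintAll (x : Place F) : LinearEquiv.refl ℚ (Carrier x) ∈ stripPrintAll logv x := by
  cases x with
  | inl w => exact refl_mem_ind1StripArch w
  | inr v => exact refl_mem_ind1Strip logv v

/-- c312-1's finite-place print slot (trivial at `∞`) lies in the every-place print slot. [claim: Mochizuki2012, status: disputed] -/
theorem stripPrint_subset_stripPrintAll (x : Place F) : stripPrint logv x ⊆ stripPrintAll logv x := by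
  cases x with
  | inl w => exact stripAutDH_subset_ind1StripArch w
  | inr v => exact fun _ h => h

/-- At an infinite place the inclusion is STRICT (`{1} ⊂ {1, −1}`). [claim: Mochizuki2012, status: disputed] -/
theorem stripPrint_ssubset_stripPrintAll_inl (w : InfinitePlace F) :
    stripPrint logv (.inl w : Place F) ⊂ stripPrintAll logv (.inl w) :=
  stripAutDH_ssubset_ind1StripArch w

/-- At a finite place the two slots coincide. [folklore] -/
theorem stripPrintAll_inr (v : HeightOneSpectrum (𝓞 F)) :
    stripPrintAll logv (.inr v : Place F) = stripPrint logv (.inr v) := rfl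

/-- Dupuy–Hilado's trivialised strip slot lies in print's every-place slot. [cite: DupuyHilado2025, §4.7] -/
theorem stripAutDH_subset_stripPrintAll (x : Place F) : stripAutDH x ⊆ stripPrintAll logv x :=
  (stripAutDH_subset_stripPrint logv x).trans (stripPrint_subset_stripPrintAll logv x)

/-- **Print's every-place strip slot `⊆` the typed DH (Ind2) slot, place by place** (finite: c312-1
`ind1Strip_subset_ismDH`; infinite: `ind1StripArch_eq_ismDH`). [cite: DupuyHilado2025, §4.9] [claim: Mochizuki2012, status: disputed] -/
theorem stripPrintAll_subset_ismDH (x : Place F) : stripPrintAll logv x ⊆ ismDH logv x := by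
  cases x with
  | inl w => exact (ind1StripArch_eq_ismDH logv w).le
  | inr v => exact ind1Strip_subset_ismDH logv v

/-- **`Thm311.LogShells` with PRINT'S EVERY-PLACE (Ind1) strip slot and PRINT'S nonarchimedean (Ind2) slot**.
[claim: Mochizuki2012, status: disputed] -/
def logShellsPrintAll : LogShells (thetaIndex X) :=
  logShells X logv (stripPrintAll logv) (ismPrint logv) (refl_mem_stripPrintAll logv) (refl_mem_ismPrint logv)

/-! ## 2. The sandwich -/

/-- (Ind1) over c312-1's finite-place print slot `⊆` (Ind1) over the every-place print slot. [claim: Mochizuki2012, status: disputed] -/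
theorem Ind1_print_subset_Ind1_printAll (j : (thetaIndex X).Label) :
    (logShellsPrint X logv).Ind1 j ⊆ (logShellsPrintAll X logv).Ind1 j :=
  Ind1_mono X logv (refl_mem_stripPrint logv) (refl_mem_stripPrintAll logv) (refl_mem_ismPrint logv)
    (stripPrint_subset_stripPrintAll logv) j

/-- (Ind2) is unchanged by the strip slot (same Ism slot `ismPrint`). [folklore] -/
theorem Ind2Family_printAll_eq :
    (logShellsPrintAll X logv).Ind2Family =
      (show Set (logShellsPrintAll X logv).PacketAut from (logShellsIsm X logv).Ind2Family) :=
  rfl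

/-- **`⟨Ind1, Ind2⟩(stripPrint, ismPrint) ≤ ⟨Ind1, Ind2⟩(stripPrintAll, ismPrint)`** — adding print's archimedean strip
automorphisms only enlarges the typed indeterminacy group. [claim: Mochizuki2012, status: disputed] -/
theorem indGroup_print_le_printAll :
    (logShellsPrint X logv).IndGroup ≤
      (show Subgroup (logShellsPrint X logv).PacketAut from (logShellsPrintAll X logv).IndGroup) := by
  change Subgroup.closure _ ≤ Subgroup.closure _
  refine Subgroup.closure_mono ?_
  rintro Φ (hΦ | hΦ)
  · exact Or.inl fun j => Ind1_print_subset_Ind1_printAll X logv j (hΦ j)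
  · refine Or.inr ?_
    rw [Ind2Family_printAll_eq]
    rw [Ind2Family_print_eq] at hΦ
    exact hΦ

/-- An (Ind1)-automorphism over print's EVERY-PLACE strip slot is a capsule permutation COMPOSED WITH an (Ind2)-automorphism
over DH's slot (the strip automorphisms lie in `ismDH` at every place, `stripPrintAll_subset_ismDH`, and act summand-wise,
factor-wise). [cite: DupuyHilado2025, §4.9] [claim: Mochizuki2012, status: disputed] -/
theorem exists_Ind2_DH_of_mem_Ind1_printAll {j : (thetaIndex X).Label}
    {Φ : ∀ vQ, (logShellsPrintAll X logv).Packet j vQ ≃ₗ[ℚ] (logShellsPrintAll X logv).Packet j vQ}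
    (hΦ : Φ ∈ (logShellsPrintAll X logv).Ind1 j) :
    ∃ (σ : Equiv.Perm ((thetaIndex X).Caps j))
      (Ψ : ∀ vQ, (logShellsDH X logv).Packet j vQ ≃ₗ[ℚ] (logShellsDH X logv).Packet j vQ),
      (∀ vQ, Ψ vQ ∈ (logShellsDH X logv).Ind2 j vQ) ∧
      ∀ vQ, Φ vQ = ((logShellsDH X logv).permute j vQ σ).trans (Ψ vQ) := by
  obtain ⟨σ, h, hh, hΦ⟩ := hΦ
  refine ⟨σ, fun vQ => (logShellsDH X logv).factorwise j vQ fun i =>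
      (logShellsDH X logv).summandwise vQ fun x => h i x.1, fun vQ => ?_, fun vQ => hΦ vQ⟩
  exact ⟨fun i x => h i x.1, fun i x => stripPrintAll_subset_ismDH logv x.1 (hh i x.1), rfl⟩

/-- **An (Ind1)-family over print's every-place strip slot lies in DH's indeterminacy group.**
[cite: DupuyHilado2025, §4.9] [claim: Mochizuki2012, status: disputed] -/
theorem ind1Family_printAll_subset_indGroup_DH :
    (logShellsPrintAll X logv).Ind1Family ⊆
      (show Set (logShellsPrintAll X logv).PacketAut from
        ((logShellsDH X logv).IndGroup : Set (logShellsDH X logv).PacketAut)) := by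
  intro Φ hΦ
  choose σ Ψ hΨ hΦσ using fun j => exists_Ind2_DH_of_mem_Ind1_printAll X logv (hΦ j)
  let P : (logShellsDH X logv).PacketAut := fun j vQ => (logShellsDH X logv).permute j vQ (σ j)
  have hP : P ∈ (logShellsDH X logv).Ind1Family := fun j => permute_mem_Ind1_DH X logv j (σ j)
  have hΨ' : (fun j vQ => Ψ j vQ) ∈ (logShellsDH X logv).Ind2Family := fun j vQ => hΨ j vQ
  have hprod : (show (logShellsDH X logv).PacketAut from Φ) = (fun j vQ => Ψ j vQ) * P := by
    funext j vQ
    exact hΦσ j vQ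
  change (show (logShellsDH X logv).PacketAut from Φ) ∈ (logShellsDH X logv).IndGroup
  rw [hprod]
  exact (logShellsDH X logv).IndGroup.mul_mem ((logShellsDH X logv).ind2Family_subset_indGroup hΨ')
    ((logShellsDH X logv).ind1Family_subset_indGroup hP)

/-- **THE SANDWICH, upper half at every place: `⟨Ind1, Ind2⟩(stripPrintAll, ismPrint) ≤ ⟨Ind1, Ind2⟩(stripAutDH, ismDH)`**
— print's reading of (Ind1) at ALL places (finite: automorphisms of `G_v`; archimedean: automorphisms of the split monoid
`†𝒟⊢_w`) together with print's finite (Ind2) ACTS THROUGH the typed Dupuy–Hilado group: every `∀`-clause over DH's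
group restricts and every hull/orbit countermodel of record over DH's group transfers verbatim.
[cite: DupuyHilado2025, §4.9] [claim: Mochizuki2012, status: disputed] -/
theorem indGroup_printAll_le_DH :
    (logShellsPrintAll X logv).IndGroup ≤
      (show Subgroup (logShellsPrintAll X logv).PacketAut from (logShellsDH X logv).IndGroup) := by
  change Subgroup.closure _ ≤ _
  rw [Subgroup.closure_le]
  rintro Φ (hΦ | hΦ)
  · exact ind1Family_printAll_subset_indGroup_DH X logv hΦ
  · rw [Ind2Family_printAll_eq] at hΦ
    exact (logShellsDH X logv).ind2Family_subset_indGroup (Ind2Family_ismPrint_subset X logv hΦ)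

/-- **THE FULL CHAIN of typed indeterminacy groups on the real log-shells**:
`⟨Ind1,Ind2⟩(stripAutDH, ismPrint) ≤ ⟨…⟩(stripPrint, ismPrint) ≤ ⟨…⟩(stripPrintAll, ismPrint) ≤ ⟨…⟩(stripAutDH, ismDH)`
(c312-1 gens 7–8 + this file). [cite: DupuyHilado2025, §4.9] [claim: Mochizuki2012, status: disputed] -/
theorem indGroup_chain_ismPrint_print_printAll_DH :
    (logShellsIsm X logv).IndGroup ≤
        (show Subgroup (logShellsIsm X logv).PacketAut from (logShellsPrint X logv).IndGroup) ∧
      (logShellsPrint X logv).IndGroup ≤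
        (show Subgroup (logShellsPrint X logv).PacketAut from (logShellsPrintAll X logv).IndGroup) ∧
      (logShellsPrintAll X logv).IndGroup ≤
        (show Subgroup (logShellsPrintAll X logv).PacketAut from (logShellsDH X logv).IndGroup) :=
  ⟨indGroup_ismPrint_le_print X logv, indGroup_print_le_printAll X logv, indGroup_printAll_le_DH X logv⟩

end Summit.ABC.IUTFork.Thm311.Real

end
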